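import Summits.Ventures.LatticeQCDFlow.Scaling.StarHubChainFirstOrder
import Summits.Ventures.LatticeQCDFlow.Scaling.HubChainDetailedBalance

/-!
# The exactly-`j`-attempt laws: reversibility (row iterates against column iterates) and undiscounted cumulative rewards by super-solutions

**Chapter W, file 13 (lean-2 GEN-36).**  Two generic tools for MEMO-gen36's σ-free Conjecture W′ (`Σ_{j≤J} Q_j ≥ 0`, a statement about matrix powers of the two hub chains
from a common hub), in hypothesis form, no definitions:

* §1 REVERSIBILITY OF THE ITERATES: if `m(h)K(h,v) = m(v)K(v,h)` (detailed balance) then the row iterates `I_j = δ_zK^j` (the exactly-`j`-attempt laws) and the column iterates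
  `f_j = K^jδ_z` (the RETURN PROBABILITIES to `z`) satisfy `m(z)·I_j(v) = m(v)·f_j(v)` (`iterate_reversible`), hence `m(z)·E_{I_j}[g] = Σ_v m(v)f_j(v)g(v)`
  (`iterate_expect_eq`); for the star hub chain of file W4 detailed balance holds with `m = N/W` (`starHub_detailedBalance`, chapter V file 8's identity in file W4's kernel convention); `columnIterate_mem`.
* §2 UNDISCOUNTED CUMULATIVE REWARDS: for iterates `J_j` of any kernel `P` from `s₀` and functions `r, Λ` with `Λ(s) ≤ Σ_t P(s,t)(r(t) + Λ(t))` (a super-solution collecting the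
  reward at the arrival state), `Λ(s₀) − E_{J_n}[Λ] ≤ Σ_{j<n} E_{J_{j+1}}[r]` (`cumulative_ge_of_supersolution`); so a `Λ ≤ 0` with `Λ(s₀) = 0` certifies that all cumulative expected
  rewards are `≥ 0` (`cumulative_nonneg_of_supersolution`) — the undiscounted analogue of file W1's sub-solution principle, the form in which W′ is a pair-chain statement.

HONEST FRAMING: exact (Metropolis-corrected) sampling algorithms for lattice gauge theory; figures of merit are autocorrelation/cost numbers at stated couplings and volumes; no
continuum-physics claim.  Reading (no numerics implied): finite-sum identities.  NOT CLAIMED: Conjecture W′.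
-/

namespace Summit.Ventures.LatticeQCDFlow.Scaling

open Finset

/-! ## §1 Reversibility of the iterates -/

section Reversible
variable {S : Type*} [Fintype S] [DecidableEq S]

/-- **ROW ITERATES AGAINST COLUMN ITERATES UNDER DETAILED BALANCE:** `m(z)·(δ_zK^j)(v) = m(v)·(K^jδ_z)(v)`. [ours] -/
theorem iterate_reversible {K : S → S → ℝ} {m : S → ℝ} (hDB : ∀ h v, m h * K h v = m v * K v h) (z : S) {It Rt : ℕ → S → ℝ}
    (hIt0 : ∀ v, It 0 v = if v = z then 1 else 0) (hItS : ∀ j v, It (j + 1) v = ∑ h, It j h * K h v)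
    (hRt0 : ∀ v, Rt 0 v = if v = z then 1 else 0) (hRtS : ∀ j h, Rt (j + 1) h = ∑ v, K h v * Rt j v) :
    ∀ j v, m z * It j v = m v * Rt j v := by
  intro j
  induction j with
  | zero => intro v; rw [hIt0, hRt0]; split_ifs with h <;> simp [h]
  | succ n ih =>
      intro v
      rw [hItS, hRtS, mul_sum, mul_sum]
      refine sum_congr rfl fun h _ => ?_
      calc m z * (It n h * K h v) = (m z * It n h) * K h v := by ring
        _ = m h * Rt n h * K h v := by rw [ih h]
        _ = Rt n h * (m h * K h v) := by ring
        _ = Rt n h * (m v * K v h) := by rw [hDB h v]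
        _ = m v * (K v h * Rt n h) := by ring

/-- Expectations of the exactly-`j`-attempt law through return probabilities: `m(z)·Σ_v I_j(v)g(v) = Σ_v m(v)f_j(v)g(v)`. [ours] -/
theorem iterate_expect_eq {K : S → S → ℝ} {m : S → ℝ} (hDB : ∀ h v, m h * K h v = m v * K v h) (z : S) {It Rt : ℕ → S → ℝ}
    (hIt0 : ∀ v, It 0 v = if v = z then 1 else 0) (hItS : ∀ j v, It (j + 1) v = ∑ h, It j h * K h v)
    (hRt0 : ∀ v, Rt 0 v = if v = z then 1 else 0) (hRtS : ∀ j h, Rt (j + 1) h = ∑ v, K h v * Rt j v) (g : S → ℝ) (j : ℕ) :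
    m z * ∑ v, It j v * g v = ∑ v, m v * Rt j v * g v := by
  rw [mul_sum]
  refine sum_congr rfl fun v _ => ?_
  rw [← mul_assoc, iterate_reversible hDB z hIt0 hItS hRt0 hRtS j v]

/-- Column iterates of a kernel with entries in `[0,1]`-rows (non-negative, row sums `1`) stay in `[0,1]`. [ours] -/
theorem columnIterate_mem {K : S → S → ℝ} (hK0 : ∀ h v, 0 ≤ K h v) (hK1 : ∀ h, ∑ v, K h v = 1) (z : S) {Rt : ℕ → S → ℝ}
    (hRt0 : ∀ v, Rt 0 v = if v = z then 1 else 0) (hRtS : ∀ j h, Rt (j + 1) h = ∑ v, K h v * Rt j v) :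
    ∀ j h, 0 ≤ Rt j h ∧ Rt j h ≤ 1 := by
  intro j
  induction j with
  | zero => intro h; rw [hRt0]; split_ifs <;> norm_num
  | succ n ih =>
      intro h
      rw [hRtS]
      refine ⟨sum_nonneg fun v _ => mul_nonneg (hK0 h v) (ih v).1, ?_⟩
      calc ∑ v, K h v * Rt n v ≤ ∑ v, K h v * 1 := sum_le_sum fun v _ => mul_le_mul_of_nonneg_left (ih v).2 (hK0 h v)
        _ = 1 := by simp [hK1 h]

omit [Fintype S] in
/-- **DETAILED BALANCE FOR THE STAR HUB CHAIN** of file W4 with `m = N/W` (chapter V file 8's identity for file W4's kernel convention, rows of absent contents included): `(N_h/W_h)K(h,v) = (N_v/W_v)K(v,h)`. [ours] -/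
theorem starHub_detailedBalance {K : ℕ} {W : S → ℝ} {acc Kh : S → S → ℝ} {N : S → ℕ} (hW : ∀ v, 0 < W v)
    (hacc : ∀ h v, acc h v = min 1 (W h / W v))
    (hKoff : ∀ h v, h ≠ v → Kh h v = if N h = 0 then 0 else (N v : ℝ) / K * acc h v) :
    ∀ h v, (N h : ℝ) / W h * Kh h v = (N v : ℝ) / W v * Kh v h := by
  intro h v
  by_cases hhv : h = v
  · subst hhv; rfl
  have hsymm : acc h v / W h = acc v h / W v := by rw [hub_acc_mul_inv hW hacc h v, hub_acc_mul_inv hW hacc v h, min_comm]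
  rw [hKoff h v hhv, hKoff v h (Ne.symm hhv)]
  by_cases hNh : N h = 0
  · simp [hNh]
  by_cases hNv : N v = 0
  · simp [hNv]
  rw [if_neg hNh, if_neg hNv]
  calc (N h : ℝ) / W h * ((N v : ℝ) / K * acc h v) = (N h : ℝ) * (N v : ℝ) / K * (acc h v / W h) := by ring
    _ = (N h : ℝ) * (N v : ℝ) / K * (acc v h / W v) := by rw [hsymm]
    _ = (N v : ℝ) / W v * ((N h : ℝ) / K * acc v h) := by ring

end Reversible

/-! ## §2 Undiscounted cumulative rewards by super-solutions -/

section Cumulative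
variable {T : Type*} [Fintype T]

/-- **CUMULATIVE REWARDS DOMINATE A SUPER-SOLUTION:** if `Λ(s) ≤ Σ_t P(s,t)(r(t) + Λ(t))` for every `s` and `J_j` are the laws at time `j` from `J_0`
(`J_{j+1}(t) = Σ_s J_j(s)P(s,t)`, `J_j ≥ 0`), then `E_{J_0}[Λ] − E_{J_n}[Λ] ≤ Σ_{j<n} E_{J_{j+1}}[r]`. [ours] -/
theorem cumulative_ge_of_supersolution {P : T → T → ℝ} {r Λ : T → ℝ} (hsup : ∀ s, Λ s ≤ ∑ t, P s t * (r t + Λ t)) {Jt : ℕ → T → ℝ}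
    (hJ0 : ∀ j t, 0 ≤ Jt j t) (hJS : ∀ j t, Jt (j + 1) t = ∑ s, Jt j s * P s t) :
    ∀ n, ∑ t, Jt 0 t * Λ t - ∑ t, Jt n t * Λ t ≤ ∑ j ∈ range n, ∑ t, Jt (j + 1) t * r t := by
  -- one step: `E_{J_j}[Λ] ≤ E_{J_{j+1}}[r] + E_{J_{j+1}}[Λ]`
  have hstep : ∀ j, ∑ s, Jt j s * Λ s ≤ ∑ t, Jt (j + 1) t * r t + ∑ t, Jt (j + 1) t * Λ t := by
    intro j
    calc ∑ s, Jt j s * Λ s ≤ ∑ s, Jt j s * ∑ t, P s t * (r t + Λ t) := sum_le_sum fun s _ => mul_le_mul_of_nonneg_left (hsup s) (hJ0 j s)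
      _ = ∑ t, (∑ s, Jt j s * P s t) * (r t + Λ t) := by
          simp_rw [mul_sum, sum_mul]; rw [sum_comm]; exact sum_congr rfl fun t _ => sum_congr rfl fun s _ => by ring
      _ = ∑ t, Jt (j + 1) t * r t + ∑ t, Jt (j + 1) t * Λ t := by
          rw [← sum_add_distrib]; exact sum_congr rfl fun t _ => by rw [← hJS j t]; ring
  intro n
  induction n with
  | zero => simp
  | succ k ih => rw [sum_range_succ]; linarith [hstep k]

/-- **NON-NEGATIVE CUMULATIVE REWARDS FROM A NON-POSITIVE SUPER-SOLUTION VANISHING AT THE START:** if moreover `Λ ≤ 0` and `E_{J_0}[Λ] = 0` (e.g. `J_0 = δ_{s₀}`,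
`Λ(s₀) = 0`), then `Σ_{j<n} E_{J_{j+1}}[r] ≥ 0` for every `n` — the certificate form of MEMO-gen36's Conjecture W′ for a pair chain. [ours] -/
theorem cumulative_nonneg_of_supersolution {P : T → T → ℝ} {r Λ : T → ℝ} (hsup : ∀ s, Λ s ≤ ∑ t, P s t * (r t + Λ t)) (hΛ : ∀ t, Λ t ≤ 0)
    {Jt : ℕ → T → ℝ} (hJ0 : ∀ j t, 0 ≤ Jt j t) (hJS : ∀ j t, Jt (j + 1) t = ∑ s, Jt j s * P s t) (hstart : ∑ t, Jt 0 t * Λ t = 0) (n : ℕ) :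
    0 ≤ ∑ j ∈ range n, ∑ t, Jt (j + 1) t * r t := by
  have h := cumulative_ge_of_supersolution hsup hJ0 hJS n
  have hn : ∑ t, Jt n t * Λ t ≤ 0 := by
    rw [← neg_nonneg, ← sum_neg_distrib]
    exact sum_nonneg fun t _ => by have := mul_nonpos_iff.mpr (Or.inl ⟨hJ0 n t, hΛ t⟩); linarith
  linarith

end Cumulative

end Summit.Ventures.LatticeQCDFlow.Scaling
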